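import Mathlib
import HarnessLib

/-!
# Crux `DiscMajorantLog` (stmt-Parity-17114), line `Sketch`: the large-prime switch for `X² + 1`

Support lemma `stub_largePrimeSwitch` (a registered stub of the line skeleton
`Cruxes/DiscMajorantLog/Lines/Sketch.lean`), the first lemma of the idea card `switched-modulus-lsd`
for the single polynomial `f = X² + 1`: the EXACT identity
`S_x(z) = Σ_{0 ≤ n ≤ x, n²+1 x-smooth} z^{s(n²+1)}
        + z · Σ_{1 ≤ m ≤ x} z^{s(m)} · #{0 ≤ n ≤ x : m ∣ n²+1, (n²+1)/m prime, (n²+1)/m > x}`,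
where `s(m) = Σ_{p^v ∥ m} min(v,2)` (in Lean `m.factorization.sum fun _ v => min v 2`).

Mathematics (all folklore): for `x ≥ 1` and `0 ≤ n ≤ x`, `N := n² + 1 ≤ x² + 1 < (x+1)²`, so no
product `a·b` with `a, b > x` divides `N` (`LargePrimeSwitch.not_mul_dvd_sq_add_one`); hence at
most one prime `p > x` divides `N` (`LargePrimeSwitch.prime_unique`) and `p² ∤ N`
(`LargePrimeSwitch.not_dvd_div`).  Writing `N = m·p` gives `s(N) = s(m) + 1`
(`LargePrimeSwitch.capped_mul_prime`) with `1 ≤ m ≤ x` (`LargePrimeSwitch.div_mem_Icc`), and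
`m = N/p` is the only `m ∈ [1, x]` with `m ∣ N` and `N/m` a prime `> x`
(`LargePrimeSwitch.pointwise`).  Summing the pointwise identity over `0 ≤ n ≤ x` and exchanging the
order of summation gives the theorem.

No definitions are introduced; nothing here depends on the route's Theses file.
-/

namespace Summit.Parity.BatemanHorn.Cruxes.DiscMajorantLog.Sketch

open Finset

namespace LargePrimeSwitch

/-! ### Arithmetic of `n² + 1 < (x+1)²` -/

/-- No product `a * b` with `x < a`, `x < b` divides `n ^ 2 + 1` when `n ≤ x` and `1 ≤ x`
(`(x+1)² ≤ ab ≤ n²+1 ≤ x²+1 < (x+1)²`). [folklore] -/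
theorem not_mul_dvd_sq_add_one {x n a b : ℕ} (hx : 1 ≤ x) (hn : n ≤ x) (ha : x < a) (hb : x < b)
    (h : a * b ∣ n ^ 2 + 1) : False := by
  have h1 : a * b ≤ n ^ 2 + 1 := Nat.le_of_dvd (Nat.succ_pos _) h
  have h2 : (x + 1) * (x + 1) ≤ a * b := Nat.mul_le_mul (Nat.succ_le_of_lt ha) (Nat.succ_le_of_lt hb)
  have h3 : n ^ 2 ≤ x ^ 2 := Nat.pow_le_pow_left hn 2
  nlinarith

/-- Uniqueness of the large prime: two primes `> x` dividing `n ^ 2 + 1` (`n ≤ x`, `1 ≤ x`)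
coincide. [folklore] -/
theorem prime_unique {x n p q : ℕ} (hx : 1 ≤ x) (hn : n ≤ x) (hp : p.Prime) (hq : q.Prime)
    (hxp : x < p) (hxq : x < q) (hpN : p ∣ n ^ 2 + 1) (hqN : q ∣ n ^ 2 + 1) : p = q := by
  by_contra hne
  exact not_mul_dvd_sq_add_one hx hn hxp hxq
    (Nat.Coprime.mul_dvd_of_dvd_of_dvd ((Nat.coprime_primes hp hq).mpr hne) hpN hqN)

/-- The large prime divides `n ^ 2 + 1` exactly once: `p ∤ (n ^ 2 + 1) / p`. [folklore] -/
theorem not_dvd_div {x n p : ℕ} (hx : 1 ≤ x) (hn : n ≤ x) (hxp : x < p) (hpN : p ∣ n ^ 2 + 1) :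
    ¬ p ∣ (n ^ 2 + 1) / p := fun h =>
  not_mul_dvd_sq_add_one hx hn hxp hxp (Nat.mul_dvd_of_dvd_div hpN h)

/-- The cofactor `(n ^ 2 + 1) / p` of a divisor `p > x` of `n ^ 2 + 1` lies in `[1, x]`
(`p ≤ n²+1` and `n²+1 ≤ x²+1 < (x+1)·p`). [folklore] -/
theorem div_mem_Icc {x n p : ℕ} (hx : 1 ≤ x) (hn : n ≤ x) (hxp : x < p) (hpN : p ∣ n ^ 2 + 1) :
    (n ^ 2 + 1) / p ∈ Icc 1 x := by
  have hp0 : 0 < p := lt_of_le_of_lt (Nat.zero_le x) hxp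
  rw [mem_Icc]
  refine ⟨?_, ?_⟩
  · rw [Nat.le_div_iff_mul_le hp0, one_mul]
    exact Nat.le_of_dvd (Nat.succ_pos _) hpN
  · rw [← Nat.lt_add_one_iff, Nat.div_lt_iff_lt_mul hp0]
    have h2 : (x + 1) * (x + 1) ≤ (x + 1) * p := Nat.mul_le_mul_left _ (Nat.succ_le_of_lt hxp)
    have h3 : n ^ 2 ≤ x ^ 2 := Nat.pow_le_pow_left hn 2
    nlinarith

/-! ### The capped statistic of `m · p` -/

/-- `s(m · p) = s(m) + 1` for a prime `p ∤ m` (`m ≠ 0`), where `s(m) = Σ_{q^v ∥ m} min(v,2)`: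
the factorizations of `m` and `p` have disjoint supports and `s(p) = min(1,2) = 1`. [folklore] -/
theorem capped_mul_prime {m p : ℕ} (hm : m ≠ 0) (hp : p.Prime) (hpm : ¬ p ∣ m) :
    ((m * p).factorization.sum fun _ v => min v 2) =
      (m.factorization.sum fun _ v => min v 2) + 1 := by
  rw [Nat.factorization_mul hm hp.ne_zero, Finsupp.sum_add_index_of_disjoint, hp.factorization,
    Finsupp.sum_single_index (by simp)]
  · simp
  · rw [Nat.support_factorization, Nat.support_factorization, hp.primeFactors,
      Finset.disjoint_singleton_right, Nat.mem_primeFactors]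
    exact fun h => hpm h.2.1

/-! ### The pointwise switch -/

/-- Pointwise form of the switch at `0 ≤ n ≤ x` (`N := n² + 1`): if every prime factor of `N` is
`≤ x` then no `m ∈ [1, x]` has `m ∣ N` with `N/m` a prime `> x`; otherwise the prime `p > x`
dividing `N` is unique, `m = N/p` is the only such `m`, and `z^{s(N)} = z · z^{s(N/p)}`. [folklore] -/
theorem pointwise {x n : ℕ} (hx : 1 ≤ x) (hn : n ≤ x) (z : ℂ) :
    (if ¬ (∀ p ∈ (n ^ 2 + 1).primeFactors, p ≤ x) then
        z ^ ((n ^ 2 + 1).factorization.sum fun _ v => min v 2) else 0) =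
      z * ∑ m ∈ Icc 1 x, z ^ (m.factorization.sum fun _ v => min v 2) *
        (if m ∣ n ^ 2 + 1 ∧ ((n ^ 2 + 1) / m).Prime ∧ x < (n ^ 2 + 1) / m then 1 else 0) := by
  have hN : n ^ 2 + 1 ≠ 0 := Nat.succ_ne_zero _
  by_cases hP : ∀ p ∈ (n ^ 2 + 1).primeFactors, p ≤ x
  · -- no large prime: both sides vanish
    rw [if_neg (not_not_intro hP), eq_comm]
    refine mul_eq_zero_of_right _ (sum_eq_zero fun m _ => ?_)
    rw [if_neg, mul_zero]
    rintro ⟨hmN, hq, hxq⟩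
    exact absurd (hP _ (Nat.mem_primeFactors.mpr ⟨hq, Nat.div_dvd_of_dvd hmN, hN⟩)) (not_le.mpr hxq)
  · -- a (unique) large prime `p ∣ n² + 1`
    rw [if_pos hP]
    push Not at hP
    obtain ⟨p, hpF, hxp⟩ := hP
    obtain ⟨hp, hpN, -⟩ := Nat.mem_primeFactors.mp hpF
    have hm : (n ^ 2 + 1) / p ∈ Icc 1 x := div_mem_Icc hx hn hxp hpN
    have hm0 : (n ^ 2 + 1) / p ≠ 0 := Nat.one_le_iff_ne_zero.mp (mem_Icc.mp hm).1
    -- the inner sum is its single term `m = (n² + 1) / p`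
    rw [sum_eq_single_of_mem ((n ^ 2 + 1) / p) hm]
    · rw [if_pos, mul_one]
      · have key := capped_mul_prime hm0 hp (not_dvd_div hx hn hxp hpN)
        rw [Nat.div_mul_cancel hpN] at key
        rw [key, pow_succ']
      · exact ⟨Nat.div_dvd_of_dvd hpN, by rwa [Nat.div_div_self hpN hN],
          by rwa [Nat.div_div_self hpN hN]⟩
    · intro b _ hne
      rw [if_neg, mul_zero]
      rintro ⟨hbN, hq, hxq⟩
      apply hne
      have hqp : (n ^ 2 + 1) / b = p :=
        prime_unique hx hn hq hp hxq hxp (Nat.div_dvd_of_dvd hbN) hpN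
      exact Nat.eq_div_of_mul_eq_left hp.ne_zero (by rw [← hqp, Nat.mul_div_cancel' hbN])

end LargePrimeSwitch

/-- **The large-prime switch** (stub `stub_largePrimeSwitch` of line `Sketch`, crux
`DiscMajorantLog`, stmt-Parity-17114; first lemma of the idea card `switched-modulus-lsd` for
`f = X² + 1`).  For `x ≥ 1`, `S_x(z) = Σ_{0 ≤ n ≤ x} z^{s(n²+1)}` splits EXACTLY as the sum over
the `n` all of whose prime factors of `n² + 1` are `≤ x`, plus
`z · Σ_{1 ≤ m ≤ x} z^{s(m)} · #{0 ≤ n ≤ x : m ∣ n²+1, (n²+1)/m prime, (n²+1)/m > x}`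
(for the remaining `n`, `n² + 1 = m · p` with a unique prime `p > x`, `p ∤ m`, so
`s(n²+1) = s(m) + 1` and `1 ≤ m ≤ x`). [folklore] -/
theorem stub_largePrimeSwitch :
    ∀ x : ℕ, 1 ≤ x → ∀ z : ℂ,
      (∑ n ∈ Finset.range (x + 1), z ^ ((n ^ 2 + 1).factorization.sum fun _ v => min v 2)) =
        (∑ n ∈ (Finset.range (x + 1)).filter (fun n => ∀ p ∈ (n ^ 2 + 1).primeFactors, p ≤ x),
            z ^ ((n ^ 2 + 1).factorization.sum fun _ v => min v 2)) +
          z * ∑ m ∈ Finset.Icc 1 x, z ^ (m.factorization.sum fun _ v => min v 2) *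
            (((Finset.range (x + 1)).filter fun n =>
                m ∣ n ^ 2 + 1 ∧ ((n ^ 2 + 1) / m).Prime ∧ x < (n ^ 2 + 1) / m).card : ℂ) := by
  intro x hx z
  rw [← sum_filter_add_sum_filter_not (range (x + 1))
    (fun n => ∀ p ∈ (n ^ 2 + 1).primeFactors, p ≤ x)]
  congr 1
  rw [sum_filter]
  simp_rw [natCast_card_filter, mul_sum]
  rw [sum_comm]
  refine sum_congr rfl fun n hn => ?_
  rw [LargePrimeSwitch.pointwise hx (Nat.lt_add_one_iff.mp (mem_range.mp hn)) z, mul_sum]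

end Summit.Parity.BatemanHorn.Cruxes.DiscMajorantLog.Sketch
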